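import Summits.HodgeConjecture.HodgeConjecture.Theorems.ThreefoldConiveauOneOddPieces
import Summits.HodgeConjecture.HodgeConjecture.Theorems.UniruledThreefoldInputs
import HarnessLib

/-!
# The whole square of a uniruled threefold without transcendental degree-2 classes: `HC(X × X)` modulo Debarre's rational-curve fact only
# (cell `hodge-nonav`, sector SQ3 — cone-free uniruled corollaries of the coniveau-one master; target (L3) of the planner p1 g35)

PROVENANCE. Cell hodge-nonav (HUMAN RULING D-0038), planner p1 g35 (STATUS 2026-08-28T07:57:26Z / 08:12:49Z: cone-free file, target (L3)),
prover seat `hodge-nonav-20241-p1` (g11). SUPPORT FILE (`--supports stmt-HodgeConjecture-19654 --as helper`). CONE-FREE: imports only the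
coniveau-one master `Theorems/ThreefoldConiveauOneOddPieces` (seat 19716-p2, p614259) and `Theorems/UniruledThreefoldInputs` — no
`Theses` file is in the import closure. (The `E(S)`-forms of the uniruled row, including the three-fact Bertini-free
`hodgeConjectureFor_sq_of_isUniruled'`, live in the leaf `Theorems/UniruledThreefoldSquare`.)

THE POINT. The master's (A*) `hodgeConjectureFor_sq_of_algebraicClasses_one_of_supportedClasses_three_one_eq_top` proves the Hodge conjecture
for `X × X` in every codimension from `H²(X) = N¹H²(X)` and `N¹H³(X) = H³(X)` — no `B⋆`, no `E(S)`, no surface section. For a threefold with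
`CH₀(X)` supported on a surface the second input is Bloch–Srinivas (`supportedClasses_eq_top_of_hasChowZeroSupportedInDimLE_of_lt`, a tree
theorem); for a UNIRULED threefold `CH₀(X)` is on a surface by Debarre 2001 Remarks 4.2 (4) (`hasChowZeroSupportedInDimLE_two_of_isUniruled`,
ONE displayed binder). Hence:

* `hodgeConjectureFor_sq_of_algebraicClasses_one_eq_top_of_hasChowZeroSupportedInDimLE_two` — **`CH₀(X)` on a surface and `H²(X)` algebraic
  ⟹ `HC(X × X)` in every codimension, UNCONDITIONALLY**;
* `hodgeConjectureFor_sq_of_algebraicClasses_one_eq_top_of_isUniruled` — **every UNIRULED smooth projective complex threefold whose `H²` is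
  algebraic (`h^{2,0}(X) = 0`: conic bundles over rational surfaces, `ℙ¹ × (p_g = 0 surface)`, Fano threefolds, …) satisfies the Hodge
  conjecture on its WHOLE square, modulo Debarre's rational-curve fact ONLY** — no Tankeev, no `E(S)`, no `B⋆`, no Bertini;
* the `h^{2,0} = 0` binder forms `…_of_forall_isOfHodgeType_one_one…` (every rational degree-2 class of type `(1,1)` ⟹ `H² = N¹H²` by
  Lefschetz `(1,1)`, the tree's `algebraicClasses_one_eq_top_of_forall_isOfHodgeType`).

HONEST SCOPE. Structure theorems; the uniruled forms are CONDITIONAL on the displayed published fact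
`Debarre2001_uniruled_rationalCurve_through_every_point` (Debarre 2001 Rem. 4.2 (4), Lemma 3.7), the `CH₀` forms are unconditional. Nothing
here proves the Hodge conjecture for a new class beyond these rows; rung F-H1 not moved.

## References

* [BlochSrinivas1983] S. Bloch, V. Srinivas, Remarks on correspondences and algebraic cycles (1983), Thm. 1 (2).
* [Voisin2013GHCBloch] C. Voisin (2013), Lemma 2.1.
* [Debarre2001] O. Debarre, Higher-Dimensional Algebraic Geometry (2001), Remarks 4.2 (4), Lemma 3.7.
* [VoisinHodgeI2002] C. Voisin, Hodge Theory and Complex Algebraic Geometry I (2002), §7.1.1, Thm. 11.30, §11.3.3 Thm. 11.38–11.41.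
-/

set_option linter.dupNamespace false

noncomputable section

open CategoryTheory AlgebraicGeometry MonoidalCategory CartesianMonoidalCategory
open Literature.AlgebraicTopology.SingularHomology
open Literature.AlgebraicGeometry Literature.AlgebraicGeometry.Motives Literature.AlgebraicGeometry.HodgeTheory
open Literature.Barriers.HodgeConjecture
open Summit.HodgeConjecture.HodgeConjecture.Theorems

namespace Summit.HodgeConjecture.HodgeConjecture.Theorems.ThreefoldSquare

variable {X : SchemeOver ℂ}

/-! ## §1 `CH₀(X)` on a surface and `H²(X)` algebraic -/

/-- **`CH₀(X)` supported on a surface and `H²(X) = N¹H²(X)` ⟹ `HC(X × X)` in EVERY codimension, UNCONDITIONALLY** (the coniveau-one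
master (A*) with `N¹H³(X) = H³(X)` from Bloch–Srinivas). (statement: cell hodge-nonav uniruled/`h^{2,0} = 0` row; assembly not in print)
[cite: BlochSrinivas1983, Thm. 1 (2)] [cite: Voisin2013GHCBloch, Lemma 2.1] [cite: VoisinHodgeI2002, §11.3.3 Thm. 11.38–11.41] -/
theorem hodgeConjectureFor_sq_of_algebraicClasses_one_eq_top_of_hasChowZeroSupportedInDimLE_two (hX : IsSmoothProjective 3 X)
    (h₂ : algebraicClasses X 1 = ⊤) (hW : HasChowZeroSupportedInDimLE X 2) : HodgeConjectureFor 6 (X ⊗ X) :=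
  hodgeConjectureFor_sq_of_algebraicClasses_one_of_supportedClasses_three_one_eq_top hX h₂
    (supportedClasses_eq_top_of_hasChowZeroSupportedInDimLE_of_lt hX hW (by norm_num))

/-- **Hodge-type form**: `CH₀(X)` on a surface and every rational degree-2 class of type `(1,1)` (`h^{2,0}(X) = 0`) ⟹ `HC(X × X)` in every
codimension, unconditionally (`H² = N¹H²` by Lefschetz `(1,1)`, `algebraicClasses_one_eq_top_of_forall_isOfHodgeType`).
[cite: VoisinHodgeI2002, §7.1.1 and Thm. 11.30] [cite: BlochSrinivas1983, Thm. 1 (2)] -/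
theorem hodgeConjectureFor_sq_of_forall_isOfHodgeType_one_one_of_hasChowZeroSupportedInDimLE_two (hX : IsSmoothProjective 3 X)
    (h11 : ∀ c : complexBetti X (2 * 1), IsRationalClass c → IsOfHodgeType 3 X (2 * 1) 1 1 c)
    (hW : HasChowZeroSupportedInDimLE X 2) : HodgeConjectureFor 6 (X ⊗ X) :=
  hodgeConjectureFor_sq_of_algebraicClasses_one_eq_top_of_hasChowZeroSupportedInDimLE_two hX
    (algebraicClasses_one_eq_top_of_forall_isOfHodgeType hX h11) hW

/-! ## §2 Uniruled threefolds with `H²` algebraic -/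

/-- **(L3) Every UNIRULED smooth projective complex threefold whose `H²` is algebraic satisfies the Hodge conjecture on its WHOLE square
`X × X`, in every codimension — modulo Debarre's rational-curve fact ONLY** (`Debarre2001_uniruled_rationalCurve_through_every_point`:
`CH₀(X)` is supported on a surface; then §1). No Tankeev, no `E(S)`, no `B⋆`, no Bertini. Examples of the hypothesis `H² = N¹H²`:
`h^{2,0}(X) = 0` (conic bundles over rational surfaces, `ℙ¹ × S` with `p_g(S) = 0`, Fano threefolds).
(statement: cell hodge-nonav uniruled row, `h^{2,0} = 0` form; assembly not in print) [cite: Debarre2001, Remarks 4.2 (4) and Lemma 3.7]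
[cite: BlochSrinivas1983, Thm. 1 (2)] [cite: Voisin2013GHCBloch, Lemma 2.1] -/
theorem hodgeConjectureFor_sq_of_algebraicClasses_one_eq_top_of_isUniruled
    (hDeb : Debarre2001_uniruled_rationalCurve_through_every_point) (hX : IsSmoothProjective 3 X) (hU : IsUniruled X)
    (h₂ : algebraicClasses X 1 = ⊤) : HodgeConjectureFor 6 (X ⊗ X) :=
  hodgeConjectureFor_sq_of_algebraicClasses_one_eq_top_of_hasChowZeroSupportedInDimLE_two hX h₂
    (hasChowZeroSupportedInDimLE_two_of_isUniruled hDeb hX hU)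

/-- **(L3′) Hodge-type form**: a uniruled smooth projective complex threefold all of whose rational degree-2 classes are of type `(1,1)`
(`h^{2,0}(X) = 0`) satisfies the Hodge conjecture on `X × X` in every codimension, modulo Debarre's rational-curve fact only.
[cite: Debarre2001, Remarks 4.2 (4) and Lemma 3.7] [cite: VoisinHodgeI2002, Thm. 11.30] [cite: BlochSrinivas1983, Thm. 1 (2)] -/
theorem hodgeConjectureFor_sq_of_forall_isOfHodgeType_one_one_of_isUniruled
    (hDeb : Debarre2001_uniruled_rationalCurve_through_every_point) (hX : IsSmoothProjective 3 X) (hU : IsUniruled X)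
    (h11 : ∀ c : complexBetti X (2 * 1), IsRationalClass c → IsOfHodgeType 3 X (2 * 1) 1 1 c) : HodgeConjectureFor 6 (X ⊗ X) :=
  hodgeConjectureFor_sq_of_algebraicClasses_one_eq_top_of_isUniruled hDeb hX hU
    (algebraicClasses_one_eq_top_of_forall_isOfHodgeType hX h11)

end Summit.HodgeConjecture.HodgeConjecture.Theorems.ThreefoldSquare

end
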